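import Summits.HodgeConjecture.HodgeConjecture.Theorems.F0P3cStCharTSTorusRay              -- ★ p849400 «TOR-DATA★» HAND 2 (this seat): `ω` continuous ∕ involutive ∕ Haar-preserving ∕ measurable embedding; brings ★ p849333 HAND 1 (`M_c`)
import Summits.HodgeConjecture.HodgeConjecture.Theorems.F0P3cStCharTSSymmShell            -- ★ p848824 «SYMM-SHELL» (LH6-p05 g0, generic): `integral_symmShell_mul_char`, `integrable_shellFn_mul`
import Literature.NumberTheory.Automorphic.LocalLanglandsGLProofs                          -- ★ `Complex.units_eq_one_of_forall_norm_pow_sub_one_lt` («ℂˣ has no small subgroups»), ★ `exists_isOpen_subgroup_units_subset`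
import Mathlib.Topology.Algebra.Group.Units
import HarnessLib

/-!
# F0 · P3c · line LH6 «StCharTS» — «SHELL-FN★»: THE (SHF′) TARGET FUNCTION `f_{η,m₀} = e_{η,m₀} + e_{η,m₀}∘ω` ON THE SPLIT TORUS `M = E_vˣ × E¹_v` —
# locally constant, compactly supported in `m₀M_c ⊔ ω(m₀M_c)`, `ω`-symmetric, with its character integrals
# [Rogawski1990, §12.7 L. 12.7.1 (proof) p. 191; L. 12.7.2 (proof) pp. 193–194; §12.2 p. 173]

Cell `pub/hodgecm-mathlib`, crux H413 = `stmt-HodgeConjecture-24833` (`--supports` lane, helper), route HCCMUnconditional; seat LH6-p05 (g2); desk F0P3b-plan (g23)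
DEAL «SHELL-FN★» 2026-09-02T05:25:47Z.  THEOREMS ONLY, sorry-free, no definition ∕ instance ∕ notation ∕ named fact; every object is an INLINE TERM of record:
* `M := (LocalRing L v)ˣ × ↥(normOneUnits (conjLocal L c v))`, `M_c := 𝒪_vˣ × E¹_v` (the term of ★ p849333), `ω(u, z) := (σ(u)⁻¹, z)` (the term of ★ p849140);
* a character `η : M →* ℂˣ` (at the organ: `toC (cond j (wχ) χ)`, continuous by the pin and the continuity of `χ₁`, `χ₂`), a point `m₀ : M`;
* **the (SHF′) target** of ★ p849458 `stSupportFiniteSqInt_of_carpet_torus` (:159, with `toC (…)` generalised to `η`):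
  `f_{η,m₀} := fun m => (m₀ • M_c).indicator (fun m => η(m₀)·η(m)⁻¹) m + (m₀ • M_c).indicator (fun m => η(m₀)·η(m)⁻¹) (σ(m.1)⁻¹, m.2)`,
  i.e. `e_{η,m₀} + e_{η,m₀} ∘ ω` — print's `φ(α) + φ(ᾱ⁻¹)` for `φ` the `η`-isotypic function of the shell `m₀ M_c = η^m𝒪^* × E¹` [L. 12.7.2 proof p. 194].
WHAT IS PROVED — the TEST-FUNCTION SIDE of (SHF′) («`∃ φ` hyperbolic with `F_φ = f_{η,m₀}`»), i.e. what an in-house discharger must feed to a surjectivity theorem for the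
torus transform `f ↦ F_f` onto the `W`-invariant locally constant compactly supported functions on the regular part of `M`:
* §1 (any finite `v`) CHARACTERS OF `M` ARE SMOOTH: `exists_isOpen_subgroup_subset_units_localRing` (every neighbourhood of `1` in `E_vˣ = (Π_{w∣v} L_w)ˣ` contains an open
  subgroup: Mathlib `ContinuousMulEquiv.piUnits` + ★ `exists_isOpen_subgroup_units_subset` in each `L_wˣ`), `exists_isOpen_subgroup_subset_torus` (the same on `M`),
  **`isOpen_ker_of_continuous`** (a continuous `η : M →* ℂˣ` has open kernel — «`ℂˣ` has no small subgroups», ★ `Complex.units_eq_one_of_forall_norm_pow_sub_one_lt`),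
  `isLocallyConstant_of_continuous`.
* §2 (any finite `v`, compactness∕disjointness at a NON-SPLIT `v`) THE TARGET FUNCTION: `isClopen_smul_torusCompactPart` (every shell `m₀ • M_c` is clopen),
  `image_reflect_eq_preimage`, **`isLocallyConstant_shellFn`**, `support_shellFn_subset` ∕ `tsupport_shellFn_subset` (`⊆ m₀M_c ∪ ω(m₀M_c)`), **`hasCompactSupport_shellFn`**,
  **`shellFn_reflect`** (`f (ω m) = f m`), `valued_fst_apply_eq_of_mem_smul` (on the shell `m₀M_c` the first coordinate has the valuations of `m₀`),
  **`disjoint_smul_torusCompactPart_image_reflect`** (`m₀ ∉ M_c ⇒ m₀M_c ∩ ω(m₀M_c) = ∅`: `|σ(u)⁻¹|_w = |u|_w⁻¹`), hence the values `shellFn_apply_of_mem` ∕ `_of_mem_image` ∕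
  `_of_not_mem`.
* §3 (non-split `v`, Borel structure, ANY Haar measure `μ`) CHARACTER INTEGRALS: `integrable_shellFn_mul_char` and **`integral_shellFn_mul_char`**:
  `∫ f_{η,m₀}·θ dμ = θ(m₀)·μ(M_c)·[η = θ on M_c] + θ′(m₀)·μ(M_c)·[η = θ′ on M_c]` for continuous characters `θ`, `θ′ = θ∘ω` — ★ g0 `integral_symmShell_mul_char` at `a := m₀`,
  `n := 1`, its measurability ∕ boundedness ∕ `ω`-hypotheses DISCHARGED by continuity, the compact `M_c` (★ p849333) and ★ p849400.
HONEST LABEL: HC_CM is proved only modulo the 7 printed citations (2 remaining: hLiu418 = stmt-HodgeConjecture-24832, h413 = stmt-HodgeConjecture-24833) until rung 0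
closes; count-neutral brick toward an in-house discharge of the (TOR) conjunct's (SHF′) (nothing about representations is asserted).

## References
* [Rogawski1990] J. D. Rogawski, *Automorphic Representations of Unitary Groups in Three Variables*, Ann. of Math. Stud. 123 (1990): §12.2 p. 173 (`M ≅ E* × E¹`, `W`);
  §12.7 L. 12.7.1 (proof) p. 191 («there exists `f ∈ S` such that `F_f` has support in `η^m𝒪_E^* ∪ η^{−m}𝒪_E^*`»), L. 12.7.2 (proof) pp. 193–194 («there exists a function `f`
  such that `F_f(α) = φ(α) + φ(ᾱ⁻¹)`»).
* [BushnellHenniart2006] C. J. Bushnell, G. Henniart, *The Local Langlands Conjecture for GL(2)*, Grundlehren 335 (2006), §1.1 (congruence subgroups are a basis at `1`),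
  §1.5 (characters of `F^×` are smooth).
-/

set_option autoImplicit false
-- the mandated namespace has the single-problem summit's repeated segment (`HodgeConjecture.HodgeConjecture`)
set_option linter.dupNamespace false

noncomputable section

open NumberField IsDedekindDomain MeasureTheory Measure Topology Filter
open scoped NNReal ENNReal Pointwise
open Literature.NumberTheory.Automorphic Literature.NumberTheory.Automorphic.UnitaryGroup

namespace Summit.HodgeConjecture.HodgeConjecture.Cruxes.H413.F0P3cStCharTSShellFn

variable (L : Type) [Field L] [NumberField L] [IsCMField L] (v : HeightOneSpectrum (𝓞 ↥(maximalRealSubfield L)))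

/-! ## §1 Characters of `M = E_vˣ × E¹_v` are smooth (any finite `v`) -/

omit [IsCMField L] in
/-- **Every neighbourhood of `1` in `E_vˣ = (Π_{w∣v} L_w)ˣ` contains an open subgroup** (transport along Mathlib `ContinuousMulEquiv.piUnits` of the box of the
per-place congruence subgroups ★ `exists_isOpen_subgroup_units_subset`). [cite: BushnellHenniart2006, §1.1] -/
theorem exists_isOpen_subgroup_subset_units_localRing {V : Set (LocalRing L v)ˣ} (hV : V ∈ 𝓝 (1 : (LocalRing L v)ˣ)) :
    ∃ H : Subgroup (LocalRing L v)ˣ, IsOpen (H : Set (LocalRing L v)ˣ) ∧ (H : Set (LocalRing L v)ˣ) ⊆ V := by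
  let e : (LocalRing L v)ˣ ≃ₜ* ((w : PlacesOver L v) → (w.1.adicCompletion L)ˣ) := ContinuousMulEquiv.piUnits
  have hV' : ⇑e.toHomeomorph '' V ∈ 𝓝 (1 : (w : PlacesOver L v) → (w.1.adicCompletion L)ˣ) := by
    have h := e.toHomeomorph.isOpenMap.image_mem_nhds hV
    rwa [show (⇑e.toHomeomorph) 1 = 1 from map_one e] at h
  rw [nhds_pi, Filter.mem_pi] at hV'
  obtain ⟨I, -, t, ht, htV⟩ := hV'
  have hH : ∀ w : PlacesOver L v, ∃ Hw : Subgroup (w.1.adicCompletion L)ˣ, IsOpen (Hw : Set (w.1.adicCompletion L)ˣ) ∧ (Hw : Set (w.1.adicCompletion L)ˣ) ⊆ t w :=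
    fun w => exists_isOpen_subgroup_units_subset (by simpa only [Pi.one_apply] using ht w)
  choose Hw hHo hHt using hH
  refine ⟨(Subgroup.pi Set.univ Hw).comap e.toMulEquiv.toMonoidHom, ?_, ?_⟩
  · rw [Subgroup.coe_comap, Subgroup.coe_pi]
    exact (isOpen_set_pi Set.finite_univ fun w _ => hHo w).preimage e.continuous
  · intro u hu
    rw [SetLike.mem_coe, Subgroup.mem_comap, Subgroup.mem_pi] at hu
    have hu' : (e u) ∈ I.pi t := fun w _ => hHt w (hu w (Set.mem_univ w))
    obtain ⟨u', hu'V, hu'eq⟩ := htV hu'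
    have huu : u' = u := e.injective hu'eq
    exact huu ▸ hu'V

/-- **Every neighbourhood of `1` in `M = E_vˣ × E¹_v` contains an open subgroup** (`H₁ × (H₁ ∩ E¹)` for a small open subgroup `H₁ ≤ E_vˣ`).
[cite: BushnellHenniart2006, §1.1] [cite: Rogawski1990, §12.2 p. 173] -/
theorem exists_isOpen_subgroup_subset_torus {V : Set ((LocalRing L v)ˣ × ↥(normOneUnits (conjLocal L (IsCMField.complexConj L) v)))} (hV : V ∈ 𝓝 (1 : ((LocalRing L v)ˣ × ↥(normOneUnits (conjLocal L (IsCMField.complexConj L) v))))) :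
    ∃ H : Subgroup ((LocalRing L v)ˣ × ↥(normOneUnits (conjLocal L (IsCMField.complexConj L) v))), IsOpen (H : Set ((LocalRing L v)ˣ × ↥(normOneUnits (conjLocal L (IsCMField.complexConj L) v)))) ∧ (H : Set ((LocalRing L v)ˣ × ↥(normOneUnits (conjLocal L (IsCMField.complexConj L) v)))) ⊆ V := by
  have hV1 : V ∈ 𝓝 ((1 : (LocalRing L v)ˣ), (1 : ↥(normOneUnits (conjLocal L (IsCMField.complexConj L) v)))) := hV
  obtain ⟨V₁, hV₁, V₂, hV₂, hprod⟩ := mem_nhds_prod_iff.1 hV1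
  rw [nhds_subtype, Filter.mem_comap] at hV₂
  obtain ⟨V₂', hV₂', hsub⟩ := hV₂
  have hV₂'' : V₂' ∈ 𝓝 (1 : (LocalRing L v)ˣ) := by simpa only [OneMemClass.coe_one] using hV₂'
  obtain ⟨H₁, hH₁o, hH₁V⟩ := exists_isOpen_subgroup_subset_units_localRing L v (Filter.inter_mem hV₁ hV₂'')
  refine ⟨H₁.prod (H₁.comap (normOneUnits (conjLocal L (IsCMField.complexConj L) v)).subtype), ?_, ?_⟩
  · rw [Subgroup.coe_prod, Subgroup.coe_comap]
    exact hH₁o.prod (hH₁o.preimage continuous_subtype_val)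
  · rintro ⟨u, z⟩ hmem
    rw [SetLike.mem_coe, Subgroup.mem_prod, Subgroup.mem_comap] at hmem
    exact hprod (Set.mk_mem_prod (hH₁V hmem.1).1 (hsub (hH₁V hmem.2).2))

/-- **A continuous character `η : M →* ℂˣ` has OPEN KERNEL** (characters of `M` are smooth): `η⁻¹{‖z − 1‖ < 1}` contains an open subgroup `H`, whose image is a
subgroup of `ℂˣ` inside that ball, hence trivial («`ℂˣ` has no small subgroups» ★ `Complex.units_eq_one_of_forall_norm_pow_sub_one_lt`), so `H ≤ ker η`.
[cite: BushnellHenniart2006, §1.5] [cite: Rogawski1990, §12.2 p. 173] -/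
theorem isOpen_ker_of_continuous (η : ((LocalRing L v)ˣ × ↥(normOneUnits (conjLocal L (IsCMField.complexConj L) v))) →* ℂˣ) (hη : Continuous η) : IsOpen (η.ker : Set ((LocalRing L v)ˣ × ↥(normOneUnits (conjLocal L (IsCMField.complexConj L) v)))) := by
  set U : Set ℂˣ := {z | ‖(z : ℂ) - 1‖ < 1} with hU
  have hUo : IsOpen U := isOpen_lt (Units.continuous_val.sub continuous_const).norm continuous_const
  have h1U : (1 : ℂˣ) ∈ U := by simp [hU]
  have hV : η ⁻¹' U ∈ 𝓝 (1 : ((LocalRing L v)ˣ × ↥(normOneUnits (conjLocal L (IsCMField.complexConj L) v)))) := (hUo.preimage hη).mem_nhds (by simpa using h1U)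
  obtain ⟨H, hHo, hHV⟩ := exists_isOpen_subgroup_subset_torus L v hV
  have hle : H ≤ η.ker := by
    intro u hu
    rw [MonoidHom.mem_ker]
    have hmem : ∀ x ∈ H, ‖((η x : ℂˣ) : ℂ) - 1‖ < 1 := fun x hx => hHV hx
    refine Complex.units_eq_one_of_forall_norm_pow_sub_one_lt (fun n => ?_) (fun n => ?_)
    · have := hmem (u ^ n) (pow_mem hu n)
      simpa [map_pow] using this
    · have := hmem (u⁻¹ ^ n) (pow_mem (inv_mem hu) n)
      simpa [map_pow, map_inv] using this
  exact Subgroup.isOpen_mono hle hHo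

/-- **A continuous character of `M` is locally constant** (constant on the cosets of its open kernel). [cite: BushnellHenniart2006, §1.5] -/
theorem isLocallyConstant_of_continuous (η : ((LocalRing L v)ˣ × ↥(normOneUnits (conjLocal L (IsCMField.complexConj L) v))) →* ℂˣ) (hη : Continuous η) : IsLocallyConstant (η : ((LocalRing L v)ˣ × ↥(normOneUnits (conjLocal L (IsCMField.complexConj L) v))) → ℂˣ) := by
  have hK := isOpen_ker_of_continuous L v η hη
  refine (IsLocallyConstant.iff_exists_open _).2 fun x => ⟨x • (η.ker : Set ((LocalRing L v)ˣ × ↥(normOneUnits (conjLocal L (IsCMField.complexConj L) v)))), hK.smul x, ?_, ?_⟩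
  · exact ⟨1, η.ker.one_mem, by simp only [smul_eq_mul, mul_one]⟩
  · rintro y ⟨k, hk, rfl⟩
    rw [SetLike.mem_coe, MonoidHom.mem_ker] at hk
    simp only [smul_eq_mul, map_mul, hk, mul_one]

/-! ## §2 The (SHF′) target function `f_{η,m₀} = e_{η,m₀} + e_{η,m₀}∘ω` -/

/-- Every shell `m₀ • M_c` is CLOPEN in `M` (`M_c` is an open subgroup ★ `isOpen_torusCompactPart`, hence closed). Any finite `v`.
[cite: Rogawski1990, §12.7 L. 12.7.1 (proof) p. 191] -/
theorem isClopen_smul_torusCompactPart (m₀ : ((LocalRing L v)ˣ × ↥(normOneUnits (conjLocal L (IsCMField.complexConj L) v)))) : IsClopen (m₀ • ((((Submonoid.pi Set.univ (fun w : PlacesOver L v => (w.1.adicCompletionIntegers L).toSubring.toSubmonoid)).units.prod (⊤ : Subgroup ↥(normOneUnits (conjLocal L (IsCMField.complexConj L) v)))) : Subgroup ((LocalRing L v)ˣ × ↥(normOneUnits (conjLocal L (IsCMField.complexConj L) v)))) : Set ((LocalRing L v)ˣ × ↥(normOneUnits (conjLocal L (IsCMField.complexConj L) v))))) := by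
  have ho := F0P3cStCharTSTorusCompactPart.isOpen_torusCompactPart L v
  exact ⟨(Subgroup.isClosed_of_isOpen _ ho).smul m₀, ho.smul m₀⟩

/-- `ω` is an involution, so `ω(S) = ω⁻¹(S)` for every `S ⊆ M`. [cite: Rogawski1990, §12.2 p. 173] -/
theorem image_reflect_eq_preimage (S : Set ((LocalRing L v)ˣ × ↥(normOneUnits (conjLocal L (IsCMField.complexConj L) v)))) : (fun p : ((LocalRing L v)ˣ × ↥(normOneUnits (conjLocal L (IsCMField.complexConj L) v))) => ((Units.map ((conjLocal L (IsCMField.complexConj L) v : LocalRing L v →+* LocalRing L v) : LocalRing L v →* LocalRing L v) p.1)⁻¹, p.2)) '' S = (fun p : ((LocalRing L v)ˣ × ↥(normOneUnits (conjLocal L (IsCMField.complexConj L) v))) => ((Units.map ((conjLocal L (IsCMField.complexConj L) v : LocalRing L v →+* LocalRing L v) : LocalRing L v →* LocalRing L v) p.1)⁻¹, p.2)) ⁻¹' S :=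
  congrFun (Set.image_eq_preimage_of_inverse (f := (fun p : ((LocalRing L v)ˣ × ↥(normOneUnits (conjLocal L (IsCMField.complexConj L) v))) => ((Units.map ((conjLocal L (IsCMField.complexConj L) v : LocalRing L v →+* LocalRing L v) : LocalRing L v →* LocalRing L v) p.1)⁻¹, p.2))) (g := (fun p : ((LocalRing L v)ˣ × ↥(normOneUnits (conjLocal L (IsCMField.complexConj L) v))) => ((Units.map ((conjLocal L (IsCMField.complexConj L) v : LocalRing L v →+* LocalRing L v) : LocalRing L v →* LocalRing L v) p.1)⁻¹, p.2)))
    (F0P3cStCharTSTorusRay.reflect_reflect L v) (F0P3cStCharTSTorusRay.reflect_reflect L v)) S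

/-- The indicator of a clopen set times a locally constant function is locally constant. [folklore] -/
theorem isLocallyConstant_indicator {X : Type*} [TopologicalSpace X] {S : Set X} (hS : IsClopen S) {g : X → ℂ} (hg : IsLocallyConstant g) :
    IsLocallyConstant (S.indicator g) := by
  classical
  refine (IsLocallyConstant.iff_exists_open _).2 fun x => ?_
  by_cases hx : x ∈ S
  · obtain ⟨U, hUo, hxU, hU⟩ := (IsLocallyConstant.iff_exists_open _).1 hg x
    refine ⟨U ∩ S, hUo.inter hS.isOpen, ⟨hxU, hx⟩, fun y hy => ?_⟩
    rw [Set.indicator_of_mem hy.2, Set.indicator_of_mem hx, hU y hy.1]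
  · refine ⟨Sᶜ, hS.compl.isOpen, hx, fun y hy => ?_⟩
    rw [Set.indicator_of_notMem hy, Set.indicator_of_notMem hx]

/-- **`f_{η,m₀}` is LOCALLY CONSTANT** for a continuous `η` (clopen shell × locally constant `η(m₀)η(·)⁻¹`, plus the same composed with the continuous `ω`).
Any finite `v`. [cite: Rogawski1990, §12.7 L. 12.7.2 (proof) p. 194] -/
theorem isLocallyConstant_shellFn (η : ((LocalRing L v)ˣ × ↥(normOneUnits (conjLocal L (IsCMField.complexConj L) v))) →* ℂˣ) (hη : Continuous η) (m₀ : ((LocalRing L v)ˣ × ↥(normOneUnits (conjLocal L (IsCMField.complexConj L) v)))) : IsLocallyConstant (fun m : ((LocalRing L v)ˣ × ↥(normOneUnits (conjLocal L (IsCMField.complexConj L) v))) => (m₀ • ((((Submonoid.pi Set.univ (fun w : PlacesOver L v => (w.1.adicCompletionIntegers L).toSubring.toSubmonoid)).units.prod (⊤ : Subgroup ↥(normOneUnits (conjLocal L (IsCMField.complexConj L) v)))) : Subgroup ((LocalRing L v)ˣ × ↥(normOneUnits (conjLocal L (IsCMField.complexConj L) v)))) : Set ((LocalRing L v)ˣ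 × ↥(normOneUnits (conjLocal L (IsCMField.complexConj L) v))))).indicator (fun m : ((LocalRing L v)ˣ × ↥(normOneUnits (conjLocal L (IsCMField.complexConj L) v))) => ((η m₀ : ℂˣ) : ℂ) * (((η m)⁻¹ : ℂˣ) : ℂ)) m + (m₀ • ((((Submonoid.pi Set.univ (fun w : PlacesOver L v => (w.1.adicCompletionIntegers L).toSubring.toSubmonoid)).units.prod (⊤ : Subgroup ↥(normOneUnits (conjLocal L (IsCMField.complexConj L) v)))) : Subgroup ((LocalRing L v)ˣ × ↥(normOneUnits (conjLocal L (IsCMField.complexConj L) v)))) : Set ((LocalRing L v)ˣ × ↥(normOneUnits (conjLocal L (IsCMField.complexConj L) v))))).indicator (fun m : ((LocalRing L v)ˣ × ↥(normOneUnits (conjLocal L (IsCMField.complexConj L) v))) => ((η m₀ : ℂˣ) : ℂ) * (((η m)⁻¹ : ℂˣ) : ℂ)) ((Units.map ((conjLocal L (IsCMField.complexConj L) v : LocalRing L v →+* LocalRing L v) : LocalRing L v →* LocalRing L v) m.1)⁻¹, m.2)) := by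
  have hg : IsLocallyConstant (fun m : ((LocalRing L v)ˣ × ↥(normOneUnits (conjLocal L (IsCMField.complexConj L) v))) => ((η m₀ : ℂˣ) : ℂ) * (((η m)⁻¹ : ℂˣ) : ℂ)) :=
    (isLocallyConstant_of_continuous L v η hη).comp (fun z : ℂˣ => ((η m₀ : ℂˣ) : ℂ) * ((z⁻¹ : ℂˣ) : ℂ))
  have he : IsLocallyConstant ((m₀ • ((((Submonoid.pi Set.univ (fun w : PlacesOver L v => (w.1.adicCompletionIntegers L).toSubring.toSubmonoid)).units.prod (⊤ : Subgroup ↥(normOneUnits (conjLocal L (IsCMField.complexConj L) v)))) : Subgroup ((LocalRing L v)ˣ × ↥(normOneUnits (conjLocal L (IsCMField.complexConj L) v)))) : Set ((LocalRing L v)ˣ × ↥(normOneUnits (conjLocal L (IsCMField.complexConj L) v))))).indicator (fun m : ((LocalRing L v)ˣ × ↥(normOneUnits (conjLocal L (IsCMField.complexConj L) v))) => ((η m₀ : ℂˣ) : ℂ) * (((η m)⁻¹ : ℂˣ) : ℂ))) :=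
    isLocallyConstant_indicator (isClopen_smul_torusCompactPart L v m₀) hg
  have heω := he.comp_continuous (F0P3cStCharTSTorusRay.continuous_reflect L v)
  exact IsLocallyConstant.comp₂ he heω (· + ·)

/-- The support of `f_{η,m₀}` lies in `m₀M_c ∪ ω(m₀M_c)`. Any finite `v`. [cite: Rogawski1990, §12.7 L. 12.7.1 (proof) p. 191] -/
theorem support_shellFn_subset (η : ((LocalRing L v)ˣ × ↥(normOneUnits (conjLocal L (IsCMField.complexConj L) v))) →* ℂˣ) (m₀ : ((LocalRing L v)ˣ × ↥(normOneUnits (conjLocal L (IsCMField.complexConj L) v)))) :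
    Function.support (fun m : ((LocalRing L v)ˣ × ↥(normOneUnits (conjLocal L (IsCMField.complexConj L) v))) => (m₀ • ((((Submonoid.pi Set.univ (fun w : PlacesOver L v => (w.1.adicCompletionIntegers L).toSubring.toSubmonoid)).units.prod (⊤ : Subgroup ↥(normOneUnits (conjLocal L (IsCMField.complexConj L) v)))) : Subgroup ((LocalRing L v)ˣ × ↥(normOneUnits (conjLocal L (IsCMField.complexConj L) v)))) : Set ((LocalRing L v)ˣ × ↥(normOneUnits (conjLocal L (IsCMField.complexConj L) v))))).indicator (fun m : ((LocalRing L v)ˣ × ↥(normOneUnits (conjLocal L (IsCMField.complexConj L) v))) => ((η m₀ : ℂˣ) : ℂ) * (((η m)⁻¹ : ℂˣ) : ℂ)) m + (m₀ • ((((Submonoid.pi Set.univ (fun w : PlacesOver L v => (w.1.adicCompletionIntegers L).toSubring.toSubmonoid)).units.prod (⊤ : Subgroup ↥(normOneUnits (conjLocal L (IsCMField.complexConj L) v)))) : Subgroup ((LocalRing L v)ˣ × ↥(normOneUnits (conjLocal L (IsCMField.complexConj L) v)))) : Set ((LocalRing L v)ˣ × ↥(normOneUnits (conjLocal L (IsCMField.complexConj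 L) v))))).indicator (fun m : ((LocalRing L v)ˣ × ↥(normOneUnits (conjLocal L (IsCMField.complexConj L) v))) => ((η m₀ : ℂˣ) : ℂ) * (((η m)⁻¹ : ℂˣ) : ℂ)) ((Units.map ((conjLocal L (IsCMField.complexConj L) v : LocalRing L v →+* LocalRing L v) : LocalRing L v →* LocalRing L v) m.1)⁻¹, m.2)) ⊆ m₀ • ((((Submonoid.pi Set.univ (fun w : PlacesOver L v => (w.1.adicCompletionIntegers L).toSubring.toSubmonoid)).units.prod (⊤ : Subgroup ↥(normOneUnits (conjLocal L (IsCMField.complexConj L) v)))) : Subgroup ((LocalRing L v)ˣ × ↥(normOneUnits (conjLocal L (IsCMField.complexConj L) v)))) : Set ((LocalRing L v)ˣ × ↥(normOneUnits (conjLocal L (IsCMField.complexConj L) v)))) ∪ (fun p : ((LocalRing L v)ˣ × ↥(normOneUnits (conjLocal L (IsCMField.complexConj L) v))) => ((Units.map ((conjLocal L (IsCMField.complexConj L) v : LocalRing L v →+* LocalRing L v) : LocalRing L v →* LocalRing L v) p.1)⁻¹, p.2)) '' (m₀ • ((((Submonoid.pi Set.univ (fun w : PlacesOver L v => (w.1.adicCompletionIntegers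 L).toSubring.toSubmonoid)).units.prod (⊤ : Subgroup ↥(normOneUnits (conjLocal L (IsCMField.complexConj L) v)))) : Subgroup ((LocalRing L v)ˣ × ↥(normOneUnits (conjLocal L (IsCMField.complexConj L) v)))) : Set ((LocalRing L v)ˣ × ↥(normOneUnits (conjLocal L (IsCMField.complexConj L) v))))) := by
  intro m hm
  rw [image_reflect_eq_preimage]
  by_contra h
  rw [Set.mem_union, not_or, Set.mem_preimage] at h
  refine hm ?_
  simp only [Set.indicator_of_notMem h.1, Set.indicator_of_notMem h.2, add_zero]

/-- The topological support of `f_{η,m₀}` lies in `m₀M_c ∪ ω(m₀M_c)` (both shells are closed). Any finite `v`. [cite: Rogawski1990, §12.7 L. 12.7.1 (proof) p. 191] -/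
theorem tsupport_shellFn_subset (η : ((LocalRing L v)ˣ × ↥(normOneUnits (conjLocal L (IsCMField.complexConj L) v))) →* ℂˣ) (m₀ : ((LocalRing L v)ˣ × ↥(normOneUnits (conjLocal L (IsCMField.complexConj L) v)))) :
    tsupport (fun m : ((LocalRing L v)ˣ × ↥(normOneUnits (conjLocal L (IsCMField.complexConj L) v))) => (m₀ • ((((Submonoid.pi Set.univ (fun w : PlacesOver L v => (w.1.adicCompletionIntegers L).toSubring.toSubmonoid)).units.prod (⊤ : Subgroup ↥(normOneUnits (conjLocal L (IsCMField.complexConj L) v)))) : Subgroup ((LocalRing L v)ˣ × ↥(normOneUnits (conjLocal L (IsCMField.complexConj L) v)))) : Set ((LocalRing L v)ˣ × ↥(normOneUnits (conjLocal L (IsCMField.complexConj L) v))))).indicator (fun m : ((LocalRing L v)ˣ × ↥(normOneUnits (conjLocal L (IsCMField.complexConj L) v))) => ((η m₀ : ℂˣ) : ℂ) * (((η m)⁻¹ : ℂˣ) : ℂ)) m + (m₀ • ((((Submonoid.pi Set.univ (fun w : PlacesOver L v => (w.1.adicCompletionIntegers L).toSubring.toSubmonoid)).units.prod (⊤ : Subgroup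 ↥(normOneUnits (conjLocal L (IsCMField.complexConj L) v)))) : Subgroup ((LocalRing L v)ˣ × ↥(normOneUnits (conjLocal L (IsCMField.complexConj L) v)))) : Set ((LocalRing L v)ˣ × ↥(normOneUnits (conjLocal L (IsCMField.complexConj L) v))))).indicator (fun m : ((LocalRing L v)ˣ × ↥(normOneUnits (conjLocal L (IsCMField.complexConj L) v))) => ((η m₀ : ℂˣ) : ℂ) * (((η m)⁻¹ : ℂˣ) : ℂ)) ((Units.map ((conjLocal L (IsCMField.complexConj L) v : LocalRing L v →+* LocalRing L v) : LocalRing L v →* LocalRing L v) m.1)⁻¹, m.2)) ⊆ m₀ • ((((Submonoid.pi Set.univ (fun w : PlacesOver L v => (w.1.adicCompletionIntegers L).toSubring.toSubmonoid)).units.prod (⊤ : Subgroup ↥(normOneUnits (conjLocal L (IsCMField.complexConj L) v)))) : Subgroup ((LocalRing L v)ˣ × ↥(normOneUnits (conjLocal L (IsCMField.complexConj L) v)))) : Set ((LocalRing L v)ˣ × ↥(normOneUnits (conjLocal L (IsCMField.complexConj L) v)))) ∪ (fun p : ((LocalRing L v)ˣ × ↥(normOneUnits (conjLocal L (IsCMField.complexConj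 L) v))) => ((Units.map ((conjLocal L (IsCMField.complexConj L) v : LocalRing L v →+* LocalRing L v) : LocalRing L v →* LocalRing L v) p.1)⁻¹, p.2)) '' (m₀ • ((((Submonoid.pi Set.univ (fun w : PlacesOver L v => (w.1.adicCompletionIntegers L).toSubring.toSubmonoid)).units.prod (⊤ : Subgroup ↥(normOneUnits (conjLocal L (IsCMField.complexConj L) v)))) : Subgroup ((LocalRing L v)ˣ × ↥(normOneUnits (conjLocal L (IsCMField.complexConj L) v)))) : Set ((LocalRing L v)ˣ × ↥(normOneUnits (conjLocal L (IsCMField.complexConj L) v))))) := by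
  refine closure_minimal (support_shellFn_subset L v η m₀) ?_
  rw [image_reflect_eq_preimage]
  exact (isClopen_smul_torusCompactPart L v m₀).isClosed.union
    ((isClopen_smul_torusCompactPart L v m₀).isClosed.preimage (F0P3cStCharTSTorusRay.continuous_reflect L v))

/-- **`f_{η,m₀}` has COMPACT SUPPORT** at a non-split `v` (inside the compact `m₀M_c ∪ ω(m₀M_c)`, ★ `isCompact_torusCompactPart`).
[cite: Rogawski1990, §12.7 L. 12.7.1 (proof) p. 191] -/
theorem hasCompactSupport_shellFn (hns : ∀ w : PlacesOver L v, IsCMField.complexConj L • w.1 = w.1) (η : ((LocalRing L v)ˣ × ↥(normOneUnits (conjLocal L (IsCMField.complexConj L) v))) →* ℂˣ) (m₀ : ((LocalRing L v)ˣ × ↥(normOneUnits (conjLocal L (IsCMField.complexConj L) v)))) :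
    HasCompactSupport (fun m : ((LocalRing L v)ˣ × ↥(normOneUnits (conjLocal L (IsCMField.complexConj L) v))) => (m₀ • ((((Submonoid.pi Set.univ (fun w : PlacesOver L v => (w.1.adicCompletionIntegers L).toSubring.toSubmonoid)).units.prod (⊤ : Subgroup ↥(normOneUnits (conjLocal L (IsCMField.complexConj L) v)))) : Subgroup ((LocalRing L v)ˣ × ↥(normOneUnits (conjLocal L (IsCMField.complexConj L) v)))) : Set ((LocalRing L v)ˣ × ↥(normOneUnits (conjLocal L (IsCMField.complexConj L) v))))).indicator (fun m : ((LocalRing L v)ˣ × ↥(normOneUnits (conjLocal L (IsCMField.complexConj L) v))) => ((η m₀ : ℂˣ) : ℂ) * (((η m)⁻¹ : ℂˣ) : ℂ)) m + (m₀ • ((((Submonoid.pi Set.univ (fun w : PlacesOver L v => (w.1.adicCompletionIntegers L).toSubring.toSubmonoid)).units.prod (⊤ : Subgroup ↥(normOneUnits (conjLocal L (IsCMField.complexConj L) v)))) : Subgroup ((LocalRing L v)ˣ × ↥(normOneUnits (conjLocal L (IsCMField.complexConj L) v)))) : Set ((LocalRing L v)ˣ × ↥(normOneUnits (conjLocal L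 (IsCMField.complexConj L) v))))).indicator (fun m : ((LocalRing L v)ˣ × ↥(normOneUnits (conjLocal L (IsCMField.complexConj L) v))) => ((η m₀ : ℂˣ) : ℂ) * (((η m)⁻¹ : ℂˣ) : ℂ)) ((Units.map ((conjLocal L (IsCMField.complexConj L) v : LocalRing L v →+* LocalRing L v) : LocalRing L v →* LocalRing L v) m.1)⁻¹, m.2)) := by
  have hc : IsCompact (m₀ • ((((Submonoid.pi Set.univ (fun w : PlacesOver L v => (w.1.adicCompletionIntegers L).toSubring.toSubmonoid)).units.prod (⊤ : Subgroup ↥(normOneUnits (conjLocal L (IsCMField.complexConj L) v)))) : Subgroup ((LocalRing L v)ˣ × ↥(normOneUnits (conjLocal L (IsCMField.complexConj L) v)))) : Set ((LocalRing L v)ˣ × ↥(normOneUnits (conjLocal L (IsCMField.complexConj L) v))))) := (F0P3cStCharTSTorusCompactPart.isCompact_torusCompactPart L v hns).smul m₀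
  refine HasCompactSupport.intro' (hc.union (hc.image (F0P3cStCharTSTorusRay.continuous_reflect L v))) ?_ fun m hm => ?_
  · rw [image_reflect_eq_preimage]
    exact (isClopen_smul_torusCompactPart L v m₀).isClosed.union
      ((isClopen_smul_torusCompactPart L v m₀).isClosed.preimage (F0P3cStCharTSTorusRay.continuous_reflect L v))
  · exact Function.notMem_support.1 fun h => hm (support_shellFn_subset L v η m₀ h)

/-- **`f_{η,m₀}` is `ω`-SYMMETRIC**: `f(ω m) = f(m)` (`ω` is an involution, ★ `reflect_reflect`). Any finite `v`. [cite: Rogawski1990, §12.7 L. 12.7.2 (proof) p. 194] -/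
theorem shellFn_reflect (η : ((LocalRing L v)ˣ × ↥(normOneUnits (conjLocal L (IsCMField.complexConj L) v))) →* ℂˣ) (m₀ m : ((LocalRing L v)ˣ × ↥(normOneUnits (conjLocal L (IsCMField.complexConj L) v)))) : (fun m : ((LocalRing L v)ˣ × ↥(normOneUnits (conjLocal L (IsCMField.complexConj L) v))) => (m₀ • ((((Submonoid.pi Set.univ (fun w : PlacesOver L v => (w.1.adicCompletionIntegers L).toSubring.toSubmonoid)).units.prod (⊤ : Subgroup ↥(normOneUnits (conjLocal L (IsCMField.complexConj L) v)))) : Subgroup ((LocalRing L v)ˣ × ↥(normOneUnits (conjLocal L (IsCMField.complexConj L) v)))) : Set ((LocalRing L v)ˣ × ↥(normOneUnits (conjLocal L (IsCMField.complexConj L) v))))).indicator (fun m : ((LocalRing L v)ˣ × ↥(normOneUnits (conjLocal L (IsCMField.complexConj L) v))) => ((η m₀ : ℂˣ) : ℂ) * (((η m)⁻¹ : ℂˣ) : ℂ)) m + (m₀ • ((((Submonoid.pi Set.univ (fun w : PlacesOver L v => (w.1.adicCompletionIntegers L).toSubring.toSubmonoid)).units.prod (⊤ : Subgroup ↥(normOneUnits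 (conjLocal L (IsCMField.complexConj L) v)))) : Subgroup ((LocalRing L v)ˣ × ↥(normOneUnits (conjLocal L (IsCMField.complexConj L) v)))) : Set ((LocalRing L v)ˣ × ↥(normOneUnits (conjLocal L (IsCMField.complexConj L) v))))).indicator (fun m : ((LocalRing L v)ˣ × ↥(normOneUnits (conjLocal L (IsCMField.complexConj L) v))) => ((η m₀ : ℂˣ) : ℂ) * (((η m)⁻¹ : ℂˣ) : ℂ)) ((Units.map ((conjLocal L (IsCMField.complexConj L) v : LocalRing L v →+* LocalRing L v) : LocalRing L v →* LocalRing L v) m.1)⁻¹, m.2)) ((fun p : ((LocalRing L v)ˣ × ↥(normOneUnits (conjLocal L (IsCMField.complexConj L) v))) => ((Units.map ((conjLocal L (IsCMField.complexConj L) v : LocalRing L v →+* LocalRing L v) : LocalRing L v →* LocalRing L v) p.1)⁻¹, p.2)) m) = (fun m : ((LocalRing L v)ˣ × ↥(normOneUnits (conjLocal L (IsCMField.complexConj L) v))) => (m₀ • ((((Submonoid.pi Set.univ (fun w : PlacesOver L v => (w.1.adicCompletionIntegers L).toSubring.toSubmonoid)).units.prod (⊤ : Subgroup ↥(normOneUnits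 (conjLocal L (IsCMField.complexConj L) v)))) : Subgroup ((LocalRing L v)ˣ × ↥(normOneUnits (conjLocal L (IsCMField.complexConj L) v)))) : Set ((LocalRing L v)ˣ × ↥(normOneUnits (conjLocal L (IsCMField.complexConj L) v))))).indicator (fun m : ((LocalRing L v)ˣ × ↥(normOneUnits (conjLocal L (IsCMField.complexConj L) v))) => ((η m₀ : ℂˣ) : ℂ) * (((η m)⁻¹ : ℂˣ) : ℂ)) m + (m₀ • ((((Submonoid.pi Set.univ (fun w : PlacesOver L v => (w.1.adicCompletionIntegers L).toSubring.toSubmonoid)).units.prod (⊤ : Subgroup ↥(normOneUnits (conjLocal L (IsCMField.complexConj L) v)))) : Subgroup ((LocalRing L v)ˣ × ↥(normOneUnits (conjLocal L (IsCMField.complexConj L) v)))) : Set ((LocalRing L v)ˣ × ↥(normOneUnits (conjLocal L (IsCMField.complexConj L) v))))).indicator (fun m : ((LocalRing L v)ˣ × ↥(normOneUnits (conjLocal L (IsCMField.complexConj L) v))) => ((η m₀ : ℂˣ) : ℂ) * (((η m)⁻¹ : ℂˣ) : ℂ)) ((Units.map ((conjLocal L (IsCMField.complexConj L) v : LocalRing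 L v →+* LocalRing L v) : LocalRing L v →* LocalRing L v) m.1)⁻¹, m.2)) m := by
  have h := F0P3cStCharTSTorusRay.reflect_reflect L v m
  simp only at h ⊢
  rw [h, add_comm]

/-- On the shell `m₀ • M_c` the first coordinate has the valuations of `m₀`: `|m.1_w|_w = |m₀.1_w|_w` (★ `mem_unitsIntegers_iff`). Any finite `v`.
[cite: Rogawski1990, §12.7 L. 12.7.1 (proof) p. 191] -/
theorem valued_fst_apply_eq_of_mem_smul {m₀ m : ((LocalRing L v)ˣ × ↥(normOneUnits (conjLocal L (IsCMField.complexConj L) v)))} (hm : m ∈ m₀ • ((((Submonoid.pi Set.univ (fun w : PlacesOver L v => (w.1.adicCompletionIntegers L).toSubring.toSubmonoid)).units.prod (⊤ : Subgroup ↥(normOneUnits (conjLocal L (IsCMField.complexConj L) v)))) : Subgroup ((LocalRing L v)ˣ × ↥(normOneUnits (conjLocal L (IsCMField.complexConj L) v)))) : Set ((LocalRing L v)ˣ × ↥(normOneUnits (conjLocal L (IsCMField.complexConj L) v))))) (w : PlacesOver L v) :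
    Valued.v ((m.1 : LocalRing L v) w) = Valued.v ((m₀.1 : LocalRing L v) w) := by
  rw [Set.mem_smul_set_iff_inv_smul_mem, smul_eq_mul, SetLike.mem_coe, Subgroup.mem_prod] at hm
  have h1 := (F0P3cStCharTSTorusCompactPart.mem_unitsIntegers_iff L v _).1 hm.1 w
  have hfst : ((m₀⁻¹ * m).1 : (LocalRing L v)ˣ) = m₀.1⁻¹ * m.1 := rfl
  rw [hfst, Units.val_mul, Pi.mul_apply, map_mul] at h1
  have hinv : Valued.v (((m₀.1⁻¹ : (LocalRing L v)ˣ) : LocalRing L v) w) * Valued.v ((m₀.1 : LocalRing L v) w) = 1 := by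
    rw [← map_mul, ← Pi.mul_apply, Units.inv_mul, Pi.one_apply, map_one]
  have hne : Valued.v (((m₀.1⁻¹ : (LocalRing L v)ˣ) : LocalRing L v) w) ≠ 0 :=
    (Valuation.ne_zero_iff _).2 (F0P3cStCharTSTorusRay.coe_apply_ne_zero L v _ w)
  exact mul_left_cancel₀ hne (h1.trans hinv.symm)

/-- The first coordinate of `ω(m)` has the INVERSE valuations at a non-split `v`: `|(σ(u)⁻¹)_w|_w = |u_w|_w⁻¹` (one place above `v`: ★ `conjLocal_apply_eq_of_smul_eq`,
★ `valued_galAdicCompletionMap`). [cite: Rogawski1990, §12.2 p. 173] -/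
theorem valued_fst_reflect_apply (hns : ∀ w : PlacesOver L v, IsCMField.complexConj L • w.1 = w.1) (m : ((LocalRing L v)ˣ × ↥(normOneUnits (conjLocal L (IsCMField.complexConj L) v)))) (w : PlacesOver L v) :
    Valued.v ((((fun p : ((LocalRing L v)ˣ × ↥(normOneUnits (conjLocal L (IsCMField.complexConj L) v))) => ((Units.map ((conjLocal L (IsCMField.complexConj L) v : LocalRing L v →+* LocalRing L v) : LocalRing L v →* LocalRing L v) p.1)⁻¹, p.2)) m).1 : LocalRing L v) w) = (Valued.v ((m.1 : LocalRing L v) w))⁻¹ := by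
  have hσ : Valued.v (((Units.map ((conjLocal L (IsCMField.complexConj L) v : LocalRing L v →+* LocalRing L v) : LocalRing L v →* LocalRing L v) m.1 : (LocalRing L v)ˣ) : LocalRing L v) w) = Valued.v ((m.1 : LocalRing L v) w) := by
    rw [Units.coe_map, MonoidHom.coe_coe, conjLocal_apply_eq_of_smul_eq (IsCMField.complexConj L) (IsCMField.complexConj_ne_one L) v w (hns w),
      valued_galAdicCompletionMap]
  have hprod : Valued.v ((((Units.map ((conjLocal L (IsCMField.complexConj L) v : LocalRing L v →+* LocalRing L v) : LocalRing L v →* LocalRing L v) m.1)⁻¹ : (LocalRing L v)ˣ) : LocalRing L v) w) *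
      Valued.v (((Units.map ((conjLocal L (IsCMField.complexConj L) v : LocalRing L v →+* LocalRing L v) : LocalRing L v →* LocalRing L v) m.1 : (LocalRing L v)ˣ) : LocalRing L v) w) = 1 := by
    rw [← map_mul, ← Pi.mul_apply, Units.inv_mul, Pi.one_apply, map_one]
  rw [hσ] at hprod
  exact eq_inv_of_mul_eq_one_left hprod

/-- **THE TWO SHELLS ARE DISJOINT**: at a non-split `v`, for `m₀ ∉ M_c`, `m₀M_c ∩ ω(m₀M_c) = ∅` — on `m₀M_c` the first coordinate has `|·|_w = |u|_w` (`u = m₀.1`), on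
`ω(m₀M_c)` it has `|·|_w = |u|_w⁻¹`, and `|u|_w = |u|_w⁻¹` forces `|u|_w = 1` at every `w`, i.e. `m₀ ∈ M_c`. [cite: Rogawski1990, §12.7 L. 12.7.1 (proof) p. 191; §12.2 p. 173] -/
theorem disjoint_smul_torusCompactPart_image_reflect (hns : ∀ w : PlacesOver L v, IsCMField.complexConj L • w.1 = w.1) {m₀ : ((LocalRing L v)ˣ × ↥(normOneUnits (conjLocal L (IsCMField.complexConj L) v)))} (hm₀ : m₀ ∉ ((Submonoid.pi Set.univ (fun w : PlacesOver L v => (w.1.adicCompletionIntegers L).toSubring.toSubmonoid)).units.prod (⊤ : Subgroup ↥(normOneUnits (conjLocal L (IsCMField.complexConj L) v))))) :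
    Disjoint (m₀ • ((((Submonoid.pi Set.univ (fun w : PlacesOver L v => (w.1.adicCompletionIntegers L).toSubring.toSubmonoid)).units.prod (⊤ : Subgroup ↥(normOneUnits (conjLocal L (IsCMField.complexConj L) v)))) : Subgroup ((LocalRing L v)ˣ × ↥(normOneUnits (conjLocal L (IsCMField.complexConj L) v)))) : Set ((LocalRing L v)ˣ × ↥(normOneUnits (conjLocal L (IsCMField.complexConj L) v))))) ((fun p : ((LocalRing L v)ˣ × ↥(normOneUnits (conjLocal L (IsCMField.complexConj L) v))) => ((Units.map ((conjLocal L (IsCMField.complexConj L) v : LocalRing L v →+* LocalRing L v) : LocalRing L v →* LocalRing L v) p.1)⁻¹, p.2)) '' (m₀ • ((((Submonoid.pi Set.univ (fun w : PlacesOver L v => (w.1.adicCompletionIntegers L).toSubring.toSubmonoid)).units.prod (⊤ : Subgroup ↥(normOneUnits (conjLocal L (IsCMField.complexConj L) v)))) : Subgroup ((LocalRing L v)ˣ × ↥(normOneUnits (conjLocal L (IsCMField.complexConj L) v)))) : Set ((LocalRing L v)ˣ × ↥(normOneUnits (conjLocal L (IsCMField.complexConj L) v)))))) := by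
  refine Set.disjoint_left.2 fun m hm hm' => hm₀ ?_
  obtain ⟨m', hm'S, rfl⟩ := hm'
  rw [Subgroup.mem_prod]
  refine ⟨(F0P3cStCharTSTorusCompactPart.mem_unitsIntegers_iff L v _).2 fun w => ?_, Subgroup.mem_top _⟩
  have h1 := valued_fst_apply_eq_of_mem_smul L v hm w
  have h2 := valued_fst_apply_eq_of_mem_smul L v hm'S w
  rw [valued_fst_reflect_apply L v hns m' w, h2] at h1
  -- `h1 : x⁻¹ = x` with `x = |u_w|_w ≠ 0`
  have hx : Valued.v ((m₀.1 : LocalRing L v) w) ≠ 0 := (Valuation.ne_zero_iff _).2 (F0P3cStCharTSTorusRay.coe_apply_ne_zero L v _ w)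
  have hsq : Valued.v ((m₀.1 : LocalRing L v) w) ^ 2 = 1 := by
    rw [pow_two]
    nth_rewrite 1 [← h1]
    exact inv_mul_cancel₀ hx
  exact le_antisymm ((pow_le_one_iff two_ne_zero).1 hsq.le) ((one_le_pow_iff two_ne_zero).1 hsq.ge)

/-- On the shell `m₀M_c` (non-split `v`, `m₀ ∉ M_c`): `f_{η,m₀}(m) = η(m₀)·η(m)⁻¹`. [cite: Rogawski1990, §12.7 L. 12.7.2 (proof) p. 194] -/
theorem shellFn_apply_of_mem (hns : ∀ w : PlacesOver L v, IsCMField.complexConj L • w.1 = w.1) (η : ((LocalRing L v)ˣ × ↥(normOneUnits (conjLocal L (IsCMField.complexConj L) v))) →* ℂˣ) {m₀ : ((LocalRing L v)ˣ × ↥(normOneUnits (conjLocal L (IsCMField.complexConj L) v)))} (hm₀ : m₀ ∉ ((Submonoid.pi Set.univ (fun w : PlacesOver L v => (w.1.adicCompletionIntegers L).toSubring.toSubmonoid)).units.prod (⊤ : Subgroup ↥(normOneUnits (conjLocal L (IsCMField.complexConj L) v)))))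
    {m : ((LocalRing L v)ˣ × ↥(normOneUnits (conjLocal L (IsCMField.complexConj L) v)))} (hm : m ∈ m₀ • ((((Submonoid.pi Set.univ (fun w : PlacesOver L v => (w.1.adicCompletionIntegers L).toSubring.toSubmonoid)).units.prod (⊤ : Subgroup ↥(normOneUnits (conjLocal L (IsCMField.complexConj L) v)))) : Subgroup ((LocalRing L v)ˣ × ↥(normOneUnits (conjLocal L (IsCMField.complexConj L) v)))) : Set ((LocalRing L v)ˣ × ↥(normOneUnits (conjLocal L (IsCMField.complexConj L) v))))) : (fun m : ((LocalRing L v)ˣ × ↥(normOneUnits (conjLocal L (IsCMField.complexConj L) v))) => (m₀ • ((((Submonoid.pi Set.univ (fun w : PlacesOver L v => (w.1.adicCompletionIntegers L).toSubring.toSubmonoid)).units.prod (⊤ : Subgroup ↥(normOneUnits (conjLocal L (IsCMField.complexConj L) v)))) : Subgroup ((LocalRing L v)ˣ × ↥(normOneUnits (conjLocal L (IsCMField.complexConj L) v)))) : Set ((LocalRing L v)ˣ × ↥(normOneUnits (conjLocal L (IsCMField.complexConj L) v))))).indicator (fun m : ((LocalRing L v)ˣ × ↥(normOneUnits (conjLocal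 L (IsCMField.complexConj L) v))) => ((η m₀ : ℂˣ) : ℂ) * (((η m)⁻¹ : ℂˣ) : ℂ)) m + (m₀ • ((((Submonoid.pi Set.univ (fun w : PlacesOver L v => (w.1.adicCompletionIntegers L).toSubring.toSubmonoid)).units.prod (⊤ : Subgroup ↥(normOneUnits (conjLocal L (IsCMField.complexConj L) v)))) : Subgroup ((LocalRing L v)ˣ × ↥(normOneUnits (conjLocal L (IsCMField.complexConj L) v)))) : Set ((LocalRing L v)ˣ × ↥(normOneUnits (conjLocal L (IsCMField.complexConj L) v))))).indicator (fun m : ((LocalRing L v)ˣ × ↥(normOneUnits (conjLocal L (IsCMField.complexConj L) v))) => ((η m₀ : ℂˣ) : ℂ) * (((η m)⁻¹ : ℂˣ) : ℂ)) ((Units.map ((conjLocal L (IsCMField.complexConj L) v : LocalRing L v →+* LocalRing L v) : LocalRing L v →* LocalRing L v) m.1)⁻¹, m.2)) m = ((η m₀ : ℂˣ) : ℂ) * (((η m)⁻¹ : ℂˣ) : ℂ) := by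
  have hdisj := disjoint_smul_torusCompactPart_image_reflect L v hns hm₀
  have hnot : (fun p : ((LocalRing L v)ˣ × ↥(normOneUnits (conjLocal L (IsCMField.complexConj L) v))) => ((Units.map ((conjLocal L (IsCMField.complexConj L) v : LocalRing L v →+* LocalRing L v) : LocalRing L v →* LocalRing L v) p.1)⁻¹, p.2)) m ∉ m₀ • ((((Submonoid.pi Set.univ (fun w : PlacesOver L v => (w.1.adicCompletionIntegers L).toSubring.toSubmonoid)).units.prod (⊤ : Subgroup ↥(normOneUnits (conjLocal L (IsCMField.complexConj L) v)))) : Subgroup ((LocalRing L v)ˣ × ↥(normOneUnits (conjLocal L (IsCMField.complexConj L) v)))) : Set ((LocalRing L v)ˣ × ↥(normOneUnits (conjLocal L (IsCMField.complexConj L) v)))) := fun h =>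
    Set.disjoint_left.1 hdisj hm (by rw [image_reflect_eq_preimage]; exact h)
  simp only [Set.indicator_of_mem hm, Set.indicator_of_notMem hnot, add_zero]

/-- On the reflected shell `ω(m₀M_c)` (non-split `v`, `m₀ ∉ M_c`): `f_{η,m₀}(m) = η(m₀)·η(ω m)⁻¹`. [cite: Rogawski1990, §12.7 L. 12.7.2 (proof) p. 194] -/
theorem shellFn_apply_of_mem_image (hns : ∀ w : PlacesOver L v, IsCMField.complexConj L • w.1 = w.1) (η : ((LocalRing L v)ˣ × ↥(normOneUnits (conjLocal L (IsCMField.complexConj L) v))) →* ℂˣ) {m₀ : ((LocalRing L v)ˣ × ↥(normOneUnits (conjLocal L (IsCMField.complexConj L) v)))} (hm₀ : m₀ ∉ ((Submonoid.pi Set.univ (fun w : PlacesOver L v => (w.1.adicCompletionIntegers L).toSubring.toSubmonoid)).units.prod (⊤ : Subgroup ↥(normOneUnits (conjLocal L (IsCMField.complexConj L) v)))))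
    {m : ((LocalRing L v)ˣ × ↥(normOneUnits (conjLocal L (IsCMField.complexConj L) v)))} (hm : m ∈ (fun p : ((LocalRing L v)ˣ × ↥(normOneUnits (conjLocal L (IsCMField.complexConj L) v))) => ((Units.map ((conjLocal L (IsCMField.complexConj L) v : LocalRing L v →+* LocalRing L v) : LocalRing L v →* LocalRing L v) p.1)⁻¹, p.2)) '' (m₀ • ((((Submonoid.pi Set.univ (fun w : PlacesOver L v => (w.1.adicCompletionIntegers L).toSubring.toSubmonoid)).units.prod (⊤ : Subgroup ↥(normOneUnits (conjLocal L (IsCMField.complexConj L) v)))) : Subgroup ((LocalRing L v)ˣ × ↥(normOneUnits (conjLocal L (IsCMField.complexConj L) v)))) : Set ((LocalRing L v)ˣ × ↥(normOneUnits (conjLocal L (IsCMField.complexConj L) v)))))) : (fun m : ((LocalRing L v)ˣ × ↥(normOneUnits (conjLocal L (IsCMField.complexConj L) v))) => (m₀ • ((((Submonoid.pi Set.univ (fun w : PlacesOver L v => (w.1.adicCompletionIntegers L).toSubring.toSubmonoid)).units.prod (⊤ : Subgroup ↥(normOneUnits (conjLocal L (IsCMField.complexConj L) v)))) : Subgroup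 ((LocalRing L v)ˣ × ↥(normOneUnits (conjLocal L (IsCMField.complexConj L) v)))) : Set ((LocalRing L v)ˣ × ↥(normOneUnits (conjLocal L (IsCMField.complexConj L) v))))).indicator (fun m : ((LocalRing L v)ˣ × ↥(normOneUnits (conjLocal L (IsCMField.complexConj L) v))) => ((η m₀ : ℂˣ) : ℂ) * (((η m)⁻¹ : ℂˣ) : ℂ)) m + (m₀ • ((((Submonoid.pi Set.univ (fun w : PlacesOver L v => (w.1.adicCompletionIntegers L).toSubring.toSubmonoid)).units.prod (⊤ : Subgroup ↥(normOneUnits (conjLocal L (IsCMField.complexConj L) v)))) : Subgroup ((LocalRing L v)ˣ × ↥(normOneUnits (conjLocal L (IsCMField.complexConj L) v)))) : Set ((LocalRing L v)ˣ × ↥(normOneUnits (conjLocal L (IsCMField.complexConj L) v))))).indicator (fun m : ((LocalRing L v)ˣ × ↥(normOneUnits (conjLocal L (IsCMField.complexConj L) v))) => ((η m₀ : ℂˣ) : ℂ) * (((η m)⁻¹ : ℂˣ) : ℂ)) ((Units.map ((conjLocal L (IsCMField.complexConj L) v : LocalRing L v →+* LocalRing L v) : LocalRing L v →* LocalRing L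 v) m.1)⁻¹, m.2)) m = ((η m₀ : ℂˣ) : ℂ) * (((η ((fun p : ((LocalRing L v)ˣ × ↥(normOneUnits (conjLocal L (IsCMField.complexConj L) v))) => ((Units.map ((conjLocal L (IsCMField.complexConj L) v : LocalRing L v →+* LocalRing L v) : LocalRing L v →* LocalRing L v) p.1)⁻¹, p.2)) m))⁻¹ : ℂˣ) : ℂ) := by
  have hdisj := disjoint_smul_torusCompactPart_image_reflect L v hns hm₀
  have hnot : m ∉ m₀ • ((((Submonoid.pi Set.univ (fun w : PlacesOver L v => (w.1.adicCompletionIntegers L).toSubring.toSubmonoid)).units.prod (⊤ : Subgroup ↥(normOneUnits (conjLocal L (IsCMField.complexConj L) v)))) : Subgroup ((LocalRing L v)ˣ × ↥(normOneUnits (conjLocal L (IsCMField.complexConj L) v)))) : Set ((LocalRing L v)ˣ × ↥(normOneUnits (conjLocal L (IsCMField.complexConj L) v)))) := fun h => Set.disjoint_left.1 hdisj h hm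
  have hin : (fun p : ((LocalRing L v)ˣ × ↥(normOneUnits (conjLocal L (IsCMField.complexConj L) v))) => ((Units.map ((conjLocal L (IsCMField.complexConj L) v : LocalRing L v →+* LocalRing L v) : LocalRing L v →* LocalRing L v) p.1)⁻¹, p.2)) m ∈ m₀ • ((((Submonoid.pi Set.univ (fun w : PlacesOver L v => (w.1.adicCompletionIntegers L).toSubring.toSubmonoid)).units.prod (⊤ : Subgroup ↥(normOneUnits (conjLocal L (IsCMField.complexConj L) v)))) : Subgroup ((LocalRing L v)ˣ × ↥(normOneUnits (conjLocal L (IsCMField.complexConj L) v)))) : Set ((LocalRing L v)ˣ × ↥(normOneUnits (conjLocal L (IsCMField.complexConj L) v)))) := by rwa [image_reflect_eq_preimage] at hm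
  simp only [Set.indicator_of_notMem hnot, Set.indicator_of_mem hin, zero_add]

/-- Off the two shells `f_{η,m₀}` vanishes. Any finite `v`. [cite: Rogawski1990, §12.7 L. 12.7.1 (proof) p. 191] -/
theorem shellFn_apply_of_not_mem (η : ((LocalRing L v)ˣ × ↥(normOneUnits (conjLocal L (IsCMField.complexConj L) v))) →* ℂˣ) {m₀ m : ((LocalRing L v)ˣ × ↥(normOneUnits (conjLocal L (IsCMField.complexConj L) v)))} (hm : m ∉ m₀ • ((((Submonoid.pi Set.univ (fun w : PlacesOver L v => (w.1.adicCompletionIntegers L).toSubring.toSubmonoid)).units.prod (⊤ : Subgroup ↥(normOneUnits (conjLocal L (IsCMField.complexConj L) v)))) : Subgroup ((LocalRing L v)ˣ × ↥(normOneUnits (conjLocal L (IsCMField.complexConj L) v)))) : Set ((LocalRing L v)ˣ × ↥(normOneUnits (conjLocal L (IsCMField.complexConj L) v)))) ∪ (fun p : ((LocalRing L v)ˣ × ↥(normOneUnits (conjLocal L (IsCMField.complexConj L) v))) => ((Units.map ((conjLocal L (IsCMField.complexConj L) v : LocalRing L v →+* LocalRing L v) : LocalRing L v →* LocalRing L v)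 p.1)⁻¹, p.2)) '' (m₀ • ((((Submonoid.pi Set.univ (fun w : PlacesOver L v => (w.1.adicCompletionIntegers L).toSubring.toSubmonoid)).units.prod (⊤ : Subgroup ↥(normOneUnits (conjLocal L (IsCMField.complexConj L) v)))) : Subgroup ((LocalRing L v)ˣ × ↥(normOneUnits (conjLocal L (IsCMField.complexConj L) v)))) : Set ((LocalRing L v)ˣ × ↥(normOneUnits (conjLocal L (IsCMField.complexConj L) v)))))) : (fun m : ((LocalRing L v)ˣ × ↥(normOneUnits (conjLocal L (IsCMField.complexConj L) v))) => (m₀ • ((((Submonoid.pi Set.univ (fun w : PlacesOver L v => (w.1.adicCompletionIntegers L).toSubring.toSubmonoid)).units.prod (⊤ : Subgroup ↥(normOneUnits (conjLocal L (IsCMField.complexConj L) v)))) : Subgroup ((LocalRing L v)ˣ × ↥(normOneUnits (conjLocal L (IsCMField.complexConj L) v)))) : Set ((LocalRing L v)ˣ × ↥(normOneUnits (conjLocal L (IsCMField.complexConj L) v))))).indicator (fun m : ((LocalRing L v)ˣ × ↥(normOneUnits (conjLocal L (IsCMField.complexConj L) v))) => ((η m₀ : ℂˣ) : ℂ) * (((η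 m)⁻¹ : ℂˣ) : ℂ)) m + (m₀ • ((((Submonoid.pi Set.univ (fun w : PlacesOver L v => (w.1.adicCompletionIntegers L).toSubring.toSubmonoid)).units.prod (⊤ : Subgroup ↥(normOneUnits (conjLocal L (IsCMField.complexConj L) v)))) : Subgroup ((LocalRing L v)ˣ × ↥(normOneUnits (conjLocal L (IsCMField.complexConj L) v)))) : Set ((LocalRing L v)ˣ × ↥(normOneUnits (conjLocal L (IsCMField.complexConj L) v))))).indicator (fun m : ((LocalRing L v)ˣ × ↥(normOneUnits (conjLocal L (IsCMField.complexConj L) v))) => ((η m₀ : ℂˣ) : ℂ) * (((η m)⁻¹ : ℂˣ) : ℂ)) ((Units.map ((conjLocal L (IsCMField.complexConj L) v : LocalRing L v →+* LocalRing L v) : LocalRing L v →* LocalRing L v) m.1)⁻¹, m.2)) m = 0 :=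
  Function.notMem_support.1 fun h => hm (support_shellFn_subset L v η m₀ h)

/-! ## §3 Character integrals of `f_{η,m₀}` (non-split `v`, Borel structure, any Haar measure) -/

/-- A continuous function is bounded on the compact `M_c` (non-split `v`). [cite: Rogawski1990, §12.7 L. 12.7.2 (proof) p. 193] -/
theorem exists_bound_on_torusCompactPart (hns : ∀ w : PlacesOver L v, IsCMField.complexConj L • w.1 = w.1) {g : ((LocalRing L v)ˣ × ↥(normOneUnits (conjLocal L (IsCMField.complexConj L) v))) → ℂ} (hg : Continuous g) :
    ∃ C : ℝ, ∀ u ∈ ((Submonoid.pi Set.univ (fun w : PlacesOver L v => (w.1.adicCompletionIntegers L).toSubring.toSubmonoid)).units.prod (⊤ : Subgroup ↥(normOneUnits (conjLocal L (IsCMField.complexConj L) v)))), ‖g u‖ ≤ C := by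
  obtain ⟨C, hC⟩ := (F0P3cStCharTSTorusCompactPart.isCompact_torusCompactPart L v hns).exists_bound_of_continuousOn hg.continuousOn
  exact ⟨C, fun u hu => hC u hu⟩

/-- **`f_{η,m₀}·θ` is INTEGRABLE** for continuous characters `η`, `θ` and any Haar measure (non-split `v`). [cite: Rogawski1990, §12.7 L. 12.7.2 (proof) p. 193] -/
theorem integrable_shellFn_mul_char (hns : ∀ w : PlacesOver L v, IsCMField.complexConj L • w.1 = w.1)
    [MeasurableSpace ((LocalRing L v)ˣ × ↥(normOneUnits (conjLocal L (IsCMField.complexConj L) v)))] [BorelSpace ((LocalRing L v)ˣ × ↥(normOneUnits (conjLocal L (IsCMField.complexConj L) v)))] (μ : Measure ((LocalRing L v)ˣ × ↥(normOneUnits (conjLocal L (IsCMField.complexConj L) v)))) [μ.IsHaarMeasure]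
    (η θ : ((LocalRing L v)ˣ × ↥(normOneUnits (conjLocal L (IsCMField.complexConj L) v))) →* ℂˣ) (hη : Continuous η) (hθ : Continuous θ) (m₀ : ((LocalRing L v)ˣ × ↥(normOneUnits (conjLocal L (IsCMField.complexConj L) v)))) :
    Integrable (fun m => (fun m : ((LocalRing L v)ˣ × ↥(normOneUnits (conjLocal L (IsCMField.complexConj L) v))) => (m₀ • ((((Submonoid.pi Set.univ (fun w : PlacesOver L v => (w.1.adicCompletionIntegers L).toSubring.toSubmonoid)).units.prod (⊤ : Subgroup ↥(normOneUnits (conjLocal L (IsCMField.complexConj L) v)))) : Subgroup ((LocalRing L v)ˣ × ↥(normOneUnits (conjLocal L (IsCMField.complexConj L) v)))) : Set ((LocalRing L v)ˣ × ↥(normOneUnits (conjLocal L (IsCMField.complexConj L) v))))).indicator (fun m : ((LocalRing L v)ˣ × ↥(normOneUnits (conjLocal L (IsCMField.complexConj L) v))) => ((η m₀ : ℂˣ) : ℂ) * (((η m)⁻¹ : ℂˣ) : ℂ)) m + (m₀ • ((((Submonoid.pi Set.univ (fun w : PlacesOver L v => (w.1.adicCompletionIntegers L).toSubring.toSubmonoid)).units.prod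 (⊤ : Subgroup ↥(normOneUnits (conjLocal L (IsCMField.complexConj L) v)))) : Subgroup ((LocalRing L v)ˣ × ↥(normOneUnits (conjLocal L (IsCMField.complexConj L) v)))) : Set ((LocalRing L v)ˣ × ↥(normOneUnits (conjLocal L (IsCMField.complexConj L) v))))).indicator (fun m : ((LocalRing L v)ˣ × ↥(normOneUnits (conjLocal L (IsCMField.complexConj L) v))) => ((η m₀ : ℂˣ) : ℂ) * (((η m)⁻¹ : ℂˣ) : ℂ)) ((Units.map ((conjLocal L (IsCMField.complexConj L) v : LocalRing L v →+* LocalRing L v) : LocalRing L v →* LocalRing L v) m.1)⁻¹, m.2)) m * ((θ m : ℂˣ) : ℂ)) μ := by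
  have hMc := F0P3cStCharTSTorusCompactPart.measurableSet_torusCompactPart L v
  have hMcfin := F0P3cStCharTSTorusCompactPart.measure_torusCompactPart_lt_top L v hns μ
  have hηm : Measurable fun m : ((LocalRing L v)ˣ × ↥(normOneUnits (conjLocal L (IsCMField.complexConj L) v))) => ((η m : ℂˣ) : ℂ) := (Units.continuous_val.comp hη).measurable
  have hθm : Measurable fun m : ((LocalRing L v)ˣ × ↥(normOneUnits (conjLocal L (IsCMField.complexConj L) v))) => ((θ m : ℂˣ) : ℂ) := (Units.continuous_val.comp hθ).measurable
  have hθωm : Measurable fun m : ((LocalRing L v)ˣ × ↥(normOneUnits (conjLocal L (IsCMField.complexConj L) v))) => ((θ ((fun p : ((LocalRing L v)ˣ × ↥(normOneUnits (conjLocal L (IsCMField.complexConj L) v))) => ((Units.map ((conjLocal L (IsCMField.complexConj L) v : LocalRing L v →+* LocalRing L v) : LocalRing L v →* LocalRing L v) p.1)⁻¹, p.2)) m) : ℂˣ) : ℂ) := hθm.comp (F0P3cStCharTSTorusRay.continuous_reflect L v).measurable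
  obtain ⟨C₁, hC₁⟩ := exists_bound_on_torusCompactPart L v hns (g := fun m : ((LocalRing L v)ˣ × ↥(normOneUnits (conjLocal L (IsCMField.complexConj L) v))) => (((η m)⁻¹ : ℂˣ) : ℂ)) (Units.continuous_val.comp hη.inv)
  obtain ⟨C₂, hC₂⟩ := exists_bound_on_torusCompactPart L v hns (g := fun m : ((LocalRing L v)ˣ × ↥(normOneUnits (conjLocal L (IsCMField.complexConj L) v))) => ((θ m : ℂˣ) : ℂ)) (Units.continuous_val.comp hθ)
  obtain ⟨C₃, hC₃⟩ := exists_bound_on_torusCompactPart L v hns (g := fun m : ((LocalRing L v)ˣ × ↥(normOneUnits (conjLocal L (IsCMField.complexConj L) v))) => ((θ ((fun p : ((LocalRing L v)ˣ × ↥(normOneUnits (conjLocal L (IsCMField.complexConj L) v))) => ((Units.map ((conjLocal L (IsCMField.complexConj L) v : LocalRing L v →+* LocalRing L v) : LocalRing L v →* LocalRing L v) p.1)⁻¹, p.2)) m) : ℂˣ) : ℂ))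
    ((Units.continuous_val.comp hθ).comp (F0P3cStCharTSTorusRay.continuous_reflect L v))
  have hω := F0P3cStCharTSTorusRay.measurePreserving_reflect L v μ
  have hωemb := F0P3cStCharTSTorusRay.measurableEmbedding_reflect L v
  -- the ω-conjugate character `θ′ = θ ∘ ω` as a homomorphism
  let θ' : ((LocalRing L v)ˣ × ↥(normOneUnits (conjLocal L (IsCMField.complexConj L) v))) →* ℂˣ := θ.comp
    ({ toFun := (fun p : ((LocalRing L v)ˣ × ↥(normOneUnits (conjLocal L (IsCMField.complexConj L) v))) => ((Units.map ((conjLocal L (IsCMField.complexConj L) v : LocalRing L v →+* LocalRing L v) : LocalRing L v →* LocalRing L v) p.1)⁻¹, p.2)), map_one' := by simp, map_mul' := F0P3cStCharTSTorusRay.reflect_mul L v } : ((LocalRing L v)ˣ × ↥(normOneUnits (conjLocal L (IsCMField.complexConj L) v))) →* ((LocalRing L v)ˣ × ↥(normOneUnits (conjLocal L (IsCMField.complexConj L) v))))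
  have hθ' : ∀ m, θ' m = θ ((fun p : ((LocalRing L v)ˣ × ↥(normOneUnits (conjLocal L (IsCMField.complexConj L) v))) => ((Units.map ((conjLocal L (IsCMField.complexConj L) v : LocalRing L v →+* LocalRing L v) : LocalRing L v →* LocalRing L v) p.1)⁻¹, p.2)) m) := fun m => rfl
  -- first term: ★ g0 `integrable_shellFn_mul` at `a := m₀`, `n := 1`
  have h1 := F0P3cStCharTSSymmShell.integrable_shellFn_mul μ _ hMc hMcfin m₀ η θ hηm hθm
    (C := max C₁ (max C₂ C₃)) (fun u hu => (hC₁ u hu).trans (le_max_left _ _)) (fun u hu => (hC₂ u hu).trans ((le_max_left _ _).trans (le_max_right _ _))) 1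
  have h2' := F0P3cStCharTSSymmShell.integrable_shellFn_mul μ _ hMc hMcfin m₀ η θ' hηm hθωm
    (C := max C₁ (max C₂ C₃)) (fun u hu => (hC₁ u hu).trans (le_max_left _ _)) (fun u hu => (hC₃ u hu).trans ((le_max_right _ _).trans (le_max_right _ _))) 1
  have h2 := (hω.integrable_comp_emb hωemb).2 h2'
  have h12 := h1.add h2
  refine h12.congr (Eventually.of_forall fun m => ?_)
  have hωω := F0P3cStCharTSTorusRay.reflect_reflect L v m
  simp only [Function.comp_def, zpow_one, hθ', Pi.add_apply] at hωω ⊢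
  rw [hωω, add_mul]

open scoped Classical in
/-- **THE CHARACTER INTEGRALS OF `f_{η,m₀}`** (non-split `v`, Borel structure, ANY Haar measure `μ`, continuous characters `η θ`, `θ′ = θ∘ω` the `W`-conjugate):
`∫ f_{η,m₀}·θ dμ = θ(m₀)·μ(M_c)·[η = θ on M_c] + θ′(m₀)·μ(M_c)·[η = θ′ on M_c]` — ★ g0 `integral_symmShell_mul_char` at `a := m₀`, `n := 1`, with its hypotheses
discharged (measurability by continuity, bounds on the compact `M_c`, the `ω`-clauses by ★ p849400). [cite: Rogawski1990, §12.7 L. 12.7.2 (proof) pp. 193–194] -/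
theorem integral_shellFn_mul_char (hns : ∀ w : PlacesOver L v, IsCMField.complexConj L • w.1 = w.1)
    [MeasurableSpace ((LocalRing L v)ˣ × ↥(normOneUnits (conjLocal L (IsCMField.complexConj L) v)))] [BorelSpace ((LocalRing L v)ˣ × ↥(normOneUnits (conjLocal L (IsCMField.complexConj L) v)))] (μ : Measure ((LocalRing L v)ˣ × ↥(normOneUnits (conjLocal L (IsCMField.complexConj L) v)))) [μ.IsHaarMeasure]
    (η θ θ' : ((LocalRing L v)ˣ × ↥(normOneUnits (conjLocal L (IsCMField.complexConj L) v))) →* ℂˣ) (hη : Continuous η) (hθ : Continuous θ) (hθ'c : Continuous θ') (hθ' : ∀ m : ((LocalRing L v)ˣ × ↥(normOneUnits (conjLocal L (IsCMField.complexConj L) v))), θ' m = θ ((fun p : ((LocalRing L v)ˣ × ↥(normOneUnits (conjLocal L (IsCMField.complexConj L) v))) => ((Units.map ((conjLocal L (IsCMField.complexConj L) v : LocalRing L v →+* LocalRing L v) : LocalRing L v →* LocalRing L v) p.1)⁻¹, p.2)) m)) (m₀ : ((LocalRing L v)ˣ × ↥(normOneUnits (conjLocal L (IsCMField.complexConj L)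 v)))) :
    ∫ m, (fun m : ((LocalRing L v)ˣ × ↥(normOneUnits (conjLocal L (IsCMField.complexConj L) v))) => (m₀ • ((((Submonoid.pi Set.univ (fun w : PlacesOver L v => (w.1.adicCompletionIntegers L).toSubring.toSubmonoid)).units.prod (⊤ : Subgroup ↥(normOneUnits (conjLocal L (IsCMField.complexConj L) v)))) : Subgroup ((LocalRing L v)ˣ × ↥(normOneUnits (conjLocal L (IsCMField.complexConj L) v)))) : Set ((LocalRing L v)ˣ × ↥(normOneUnits (conjLocal L (IsCMField.complexConj L) v))))).indicator (fun m : ((LocalRing L v)ˣ × ↥(normOneUnits (conjLocal L (IsCMField.complexConj L) v))) => ((η m₀ : ℂˣ) : ℂ) * (((η m)⁻¹ : ℂˣ) : ℂ)) m + (m₀ • ((((Submonoid.pi Set.univ (fun w : PlacesOver L v => (w.1.adicCompletionIntegers L).toSubring.toSubmonoid)).units.prod (⊤ : Subgroup ↥(normOneUnits (conjLocal L (IsCMField.complexConj L) v)))) : Subgroup ((LocalRing L v)ˣ × ↥(normOneUnits (conjLocal L (IsCMField.complexConj L) v)))) : Set ((LocalRing L v)ˣ × ↥(normOneUnits (conjLocal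 L (IsCMField.complexConj L) v))))).indicator (fun m : ((LocalRing L v)ˣ × ↥(normOneUnits (conjLocal L (IsCMField.complexConj L) v))) => ((η m₀ : ℂˣ) : ℂ) * (((η m)⁻¹ : ℂˣ) : ℂ)) ((Units.map ((conjLocal L (IsCMField.complexConj L) v : LocalRing L v →+* LocalRing L v) : LocalRing L v →* LocalRing L v) m.1)⁻¹, m.2)) m * ((θ m : ℂˣ) : ℂ) ∂μ =
      ((θ m₀ : ℂˣ) : ℂ) * (if (∀ u ∈ ((Submonoid.pi Set.univ (fun w : PlacesOver L v => (w.1.adicCompletionIntegers L).toSubring.toSubmonoid)).units.prod (⊤ : Subgroup ↥(normOneUnits (conjLocal L (IsCMField.complexConj L) v)))), η u = θ u) then (μ.real ((((Submonoid.pi Set.univ (fun w : PlacesOver L v => (w.1.adicCompletionIntegers L).toSubring.toSubmonoid)).units.prod (⊤ : Subgroup ↥(normOneUnits (conjLocal L (IsCMField.complexConj L) v)))) : Subgroup ((LocalRing L v)ˣ × ↥(normOneUnits (conjLocal L (IsCMField.complexConj L) v)))) : Set ((LocalRing L v)ˣ × ↥(normOneUnits (conjLocal L (IsCMField.complexConj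 L) v)))) : ℂ) else 0) +
        ((θ' m₀ : ℂˣ) : ℂ) * (if (∀ u ∈ ((Submonoid.pi Set.univ (fun w : PlacesOver L v => (w.1.adicCompletionIntegers L).toSubring.toSubmonoid)).units.prod (⊤ : Subgroup ↥(normOneUnits (conjLocal L (IsCMField.complexConj L) v)))), η u = θ' u) then (μ.real ((((Submonoid.pi Set.univ (fun w : PlacesOver L v => (w.1.adicCompletionIntegers L).toSubring.toSubmonoid)).units.prod (⊤ : Subgroup ↥(normOneUnits (conjLocal L (IsCMField.complexConj L) v)))) : Subgroup ((LocalRing L v)ˣ × ↥(normOneUnits (conjLocal L (IsCMField.complexConj L) v)))) : Set ((LocalRing L v)ˣ × ↥(normOneUnits (conjLocal L (IsCMField.complexConj L) v)))) : ℂ) else 0) := by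
  have hMc := F0P3cStCharTSTorusCompactPart.measurableSet_torusCompactPart L v
  have hMcfin := F0P3cStCharTSTorusCompactPart.measure_torusCompactPart_lt_top L v hns μ
  have hηm : Measurable fun m : ((LocalRing L v)ˣ × ↥(normOneUnits (conjLocal L (IsCMField.complexConj L) v))) => ((η m : ℂˣ) : ℂ) := (Units.continuous_val.comp hη).measurable
  have hθm : Measurable fun m : ((LocalRing L v)ˣ × ↥(normOneUnits (conjLocal L (IsCMField.complexConj L) v))) => ((θ m : ℂˣ) : ℂ) := (Units.continuous_val.comp hθ).measurable
  have hθ'm : Measurable fun m : ((LocalRing L v)ˣ × ↥(normOneUnits (conjLocal L (IsCMField.complexConj L) v))) => ((θ' m : ℂˣ) : ℂ) := (Units.continuous_val.comp hθ'c).measurable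
  obtain ⟨C₁, hC₁⟩ := exists_bound_on_torusCompactPart L v hns (g := fun m : ((LocalRing L v)ˣ × ↥(normOneUnits (conjLocal L (IsCMField.complexConj L) v))) => (((η m)⁻¹ : ℂˣ) : ℂ)) (Units.continuous_val.comp hη.inv)
  obtain ⟨C₂, hC₂⟩ := exists_bound_on_torusCompactPart L v hns (g := fun m : ((LocalRing L v)ˣ × ↥(normOneUnits (conjLocal L (IsCMField.complexConj L) v))) => ((θ m : ℂˣ) : ℂ)) (Units.continuous_val.comp hθ)
  obtain ⟨C₃, hC₃⟩ := exists_bound_on_torusCompactPart L v hns (g := fun m : ((LocalRing L v)ˣ × ↥(normOneUnits (conjLocal L (IsCMField.complexConj L) v))) => ((θ' m : ℂˣ) : ℂ)) (Units.continuous_val.comp hθ'c)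
  have h := F0P3cStCharTSSymmShell.integral_symmShell_mul_char μ _ hMc hMcfin m₀ (fun p : ((LocalRing L v)ˣ × ↥(normOneUnits (conjLocal L (IsCMField.complexConj L) v))) => ((Units.map ((conjLocal L (IsCMField.complexConj L) v : LocalRing L v →+* LocalRing L v) : LocalRing L v →* LocalRing L v) p.1)⁻¹, p.2))
    (F0P3cStCharTSTorusRay.measurePreserving_reflect L v μ) (F0P3cStCharTSTorusRay.measurableEmbedding_reflect L v) (F0P3cStCharTSTorusRay.reflect_reflect L v)
    η θ θ' hθ' hηm hθm hθ'm (C := max C₁ (max C₂ C₃))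
    (fun u hu => (hC₁ u hu).trans (le_max_left _ _)) (fun u hu => (hC₂ u hu).trans ((le_max_left _ _).trans (le_max_right _ _)))
    (fun u hu => (hC₃ u hu).trans ((le_max_right _ _).trans (le_max_right _ _))) 1
  simpa only [zpow_one] using h

end Summit.HodgeConjecture.HodgeConjecture.Cruxes.H413.F0P3cStCharTSShellFn

end
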